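import Summits.BirchSwinnertonDyer.BirchSwinnertonDyer.Theorems.KatoDescentPotSupersingularWildFineSelmerClassGroupRoad
import HarnessLib

/-!
# The CLASS-GROUP road to Coates–Sujatha's (A) on a row ITSELF, KT form at odd `p`, over the printed
# hypothesis (c2) of Deo–Ray–Sujatha AS PRINTED — `Hom_G(H′_L, E[p]) = 0` — instead of `p ∤ h(ℚ(E[p]))`
# (route `KatoDescentTamePotSupersingular`, rung KT, cell `bsd-potss`; crux item stmt-BirchSwinnertonDyer-19413
# `TameFineSelmerCoatesSujatha`, stub `stub_fineA_tame_five_le`; a `--supports … --as helper` file; seat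
# `bsd-potss-conjA-anchor` g7; ROUTE-FREE; nothing booked, BSD is not proved by any of this, no item is closed)

WHY. The tree's class-group road (`WildFineSelmerClassGroupRoad.missingUpperBoundAt_addv_of_classGroupCertificate`,
seat k9-c4 g7) sits on the CLASS-NUMBER form of Deo–Ray–Sujatha 2023 Thm. 3.8/3.9 (`p ∤ h(ℚ(E[p]))`). At
`p = 5` the division field `ℚ(E[5])` of a KT row has degree `32` (`5Ns`), `48` (`5Nn`) or `96` (`5S4`): its
class number is out of computational reach. The printed hypothesis is weaker — (c2) «`Hom_G(H′_L, E[p]) = 0`»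
— and is typed VERBATIM by the Literature fact
`DeoRaySujatha2023.thm39_fineSelmerDual_moduleFinite_of_homTrivial_divisionField` (conjA-anchor g4,
p499746). This file is the KT road over THAT fact: Upper at `(W,p)` from `r_an = 0`, `Addv W p`,
`0 ≤ v_p(j)`, `W[p]` irreducible, (c1) `p ∤ #Gal(ℚ(W[p])/ℚ)`, (c2) as printed (DISPLAYED, binder `hhom`),
(c3) no `D_v`-fixed `p`-torsion at `v = p` and at the bad places. The census of conjA-anchor g7 (kit
j283612 / j287355, memo `pub/bsd-potss/conjA-anchor/g7/FINDING-19413-…-g7.md` §5) supplies (c2) for a row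
from ONE class number: `5 ∤ h(ℚ(P))`, `P` a point of order `5` (`[ℚ(P):ℚ] = 8` on `5Ns` rows, `24` on
`5Nn`/`5S4`), by the elementary lemma recorded there (`𝔽₅[G]` semisimple as `5 ∤ #G`; `E[5]` is a direct
summand of the permutation module `𝔽₅[G/Stab P]`; `Hom_G(𝔽₅[G/H], H_L) = H_L^H ≅ Cl(ℚ(P))/5`) — evidence
for the displayed binder, not a kernel input. HONEST FRAMING: conditional on the displayed named facts
(`hDRS`, `hKatoA`, GZK, modularity); on ♯ rows (c3) fails (`sharpRow_exists_local_pTorsion`, p439271), so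
this road serves ♭ rows only; class-wide the crux is Coates–Sujatha (A), a named open problem.

References: [DeoRaySujatha2023] Thm. 3.8 (c2), Thm. 3.9 (b), Lemma 5.1; [Kato2004Asterisque] Thm. 14.5 (3),
Prop. 14.16 (2); [CoatesSujatha2005] §3 Conjecture A.
-/

set_option autoImplicit false
-- sibling precedent (`KatoDescentPotSupersingularAssembly.lean`): the directory name repeats the summit name
set_option linter.dupNamespace false

noncomputable section

open scoped Classical nonZeroDivisors NumberField

namespace Summit.BirchSwinnertonDyer.BirchSwinnertonDyer.Theorems.TameFineSelmerClassGroupHomRoad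

open NumberField IsDedekindDomain Field
open WeierstrassCurve Literature.NumberTheory.EllipticCurves
  Literature.NumberTheory.EllipticCurves.GreenbergSelmer
  Literature.NumberTheory.EllipticCurves.IwasawaAlgebra
  Literature.NumberTheory.EllipticCurves.Rank1Residual
  Literature.NumberTheory.EllipticCurves.Rank1Residual.Typed
  Literature.NumberTheory.EllipticCurves.ZpExtension
  Literature.NumberTheory.GaloisRepresentations
  Summit.BirchSwinnertonDyer.Rank1Residual Summit.BirchSwinnertonDyer.Rank1Residual.Additive
  Summit.BirchSwinnertonDyer.Rank1Residual.O6
  Summit.BirchSwinnertonDyer.BirchSwinnertonDyer.Theorems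

/-- **The CLASS-GROUP road, KT row form, (c2) AS PRINTED.** At an additive, potentially good odd prime
`p` (`Addv W p`, `0 ≤ v_p(j)`), for `W/ℚ` globally minimal with `r_an = 0` and `W[p]` irreducible:
(c1) `p ∤ #Gal(ℚ(W[p])/ℚ)`, (c2) every `Gal`-equivariant additive map `Cl(ℚ(W[p])) → W[p]` vanishing on
the classes of the primes above `p` and above the bad primes is zero (Deo–Ray–Sujatha's
`Hom_G(H′_L, E[p]) = 0`, verbatim as typed by the fact), (c3) no non-zero `D_v`-fixed `p`-torsion at
`v = p` and at the bad places ⟹ `MissingUpperBoundAt W p` — (A) at `(W,p)` by `hDRS`, then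
`TameFineSelmerSupersingularUnitAnchor.missingUpperBoundAt_addv_of_conjA` (Kato's fine reading, GZK,
modularity). No anchor, no congruence, no Lim–Sujatha transfer, no class NUMBER of the division field.
[cite: DeoRaySujatha2023, Thm. 3.8 (c2) and Thm. 3.9 (b) with Lemma 5.1]
[cite: Kato2004Asterisque, Thm. 14.5 (3) and Prop. 14.16 (2)] [cite: CoatesSujatha2005, §3 Conjecture A] -/
theorem missingUpperBoundAt_addv_of_homTrivialClassGroupCertificate
    (hDRS : DeoRaySujatha2023.thm39_fineSelmerDual_moduleFinite_of_homTrivial_divisionField)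
    (hKatoA :
      Kato2004.rankZero_padicValNat_sha_add_padicValNat_tamagawa_le_of_additive_potGood_of_irreducible_of_fineSelmerDual_fg)
    (hGZK : rank_eq_analyticRank_of_analyticRank_le_one) (hmod : hasEntireLFunction_rat)
    (W : WeierstrassCurve ℚ) [W.IsElliptic] [W.IsGloballyMinimal] (p : ℕ) [Fact p.Prime]
    (hr : W.analyticRank = 0) (hp : p ≠ 2) (hA : Addv W p) (hj : 0 ≤ padicValRat p W.j)
    (hirr : W.HasIrreducibleModPGaloisRep p)
    (hG : haveI : NeZero p := ⟨(Fact.out : p.Prime).ne_zero⟩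
      ¬ p ∣ Nat.card ((W.divisionField p) ≃ₐ[ℚ] (W.divisionField p)))
    (hhom : haveI : NeZero p := ⟨(Fact.out : p.Prime).ne_zero⟩
     haveI : NumberField (W.divisionField p) := NumberField.mk
     ∀ f : Additive (ClassGroup (𝓞 (W.divisionField p))) →+ geomTorsion W (p : ℤ),
      (∀ (τ : Field.absoluteGaloisGroup ℚ) (I J : (Ideal (𝓞 (W.divisionField p)))⁰),
          (J : Ideal (𝓞 (W.divisionField p))) =
            (I : Ideal (𝓞 (W.divisionField p))).map
              (galRestrict ℤ ℚ (W.divisionField p) (𝓞 (W.divisionField p))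
                (absRestrictNormalHom (W.divisionField p) τ)) →
          f (Additive.ofMul (ClassGroup.mk0 J)) = τ • f (Additive.ofMul (ClassGroup.mk0 I))) →
      (∀ (𝔓 : HeightOneSpectrum (𝓞 (W.divisionField p))) (I : (Ideal (𝓞 (W.divisionField p)))⁰)
          (q : ℕ) (v : HeightOneSpectrum (𝓞 ℚ)), q.Prime →
          (I : Ideal (𝓞 (W.divisionField p))) = 𝔓.asIdeal →
          ((q : ℕ) : 𝓞 (W.divisionField p)) ∈ 𝔓.asIdeal → ((q : ℕ) : 𝓞 ℚ) ∈ v.asIdeal →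
          (q = p ∨ ¬ W.HasGoodReductionAt v) →
          f (Additive.ofMul (ClassGroup.mk0 I)) = 0) →
      f = 0)
    (hloc : ∀ v : HeightOneSpectrum (𝓞 ℚ), (((p : ℕ) : 𝓞 ℚ) ∈ v.asIdeal ∨ ¬ W.HasGoodReductionAt v) →
      ∀ x : W.geomPrimaryTorsion p, p • x = 0 → (∀ d ∈ decomp v, d • x = x) → x = 0) :
    MissingUpperBoundAt W p :=
  TameFineSelmerSupersingularUnitAnchor.missingUpperBoundAt_addv_of_conjA hKatoA hGZK hmod W p hr hp hA hj
    hirr (hDRS W p hp hirr hG hhom hloc)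

/-- **The (A)-form for the stub `stub_fineA_tame_five_le` on ONE row**: the crux's `∃ γ D, Module.Finite …`
conclusion for `W` at `p` from the row's own class-group certificate with (c2) as printed — the fact applied,
nothing else (no `r_an`, `Addv`, image-type hypotheses are needed for (A) itself).
[cite: DeoRaySujatha2023, Thm. 3.8 (c2) and Thm. 3.9 (b) with Lemma 5.1] -/
theorem conjA_of_homTrivialClassGroupCertificate
    (hDRS : DeoRaySujatha2023.thm39_fineSelmerDual_moduleFinite_of_homTrivial_divisionField)
    (W : WeierstrassCurve ℚ) [W.IsElliptic] (p : ℕ) [Fact p.Prime] (hp : p ≠ 2)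
    (hirr : W.HasIrreducibleModPGaloisRep p)
    (hG : haveI : NeZero p := ⟨(Fact.out : p.Prime).ne_zero⟩
      ¬ p ∣ Nat.card ((W.divisionField p) ≃ₐ[ℚ] (W.divisionField p)))
    (hhom : haveI : NeZero p := ⟨(Fact.out : p.Prime).ne_zero⟩
     haveI : NumberField (W.divisionField p) := NumberField.mk
     ∀ f : Additive (ClassGroup (𝓞 (W.divisionField p))) →+ geomTorsion W (p : ℤ),
      (∀ (τ : Field.absoluteGaloisGroup ℚ) (I J : (Ideal (𝓞 (W.divisionField p)))⁰),
          (J : Ideal (𝓞 (W.divisionField p))) =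
            (I : Ideal (𝓞 (W.divisionField p))).map
              (galRestrict ℤ ℚ (W.divisionField p) (𝓞 (W.divisionField p))
                (absRestrictNormalHom (W.divisionField p) τ)) →
          f (Additive.ofMul (ClassGroup.mk0 J)) = τ • f (Additive.ofMul (ClassGroup.mk0 I))) →
      (∀ (𝔓 : HeightOneSpectrum (𝓞 (W.divisionField p))) (I : (Ideal (𝓞 (W.divisionField p)))⁰)
          (q : ℕ) (v : HeightOneSpectrum (𝓞 ℚ)), q.Prime →
          (I : Ideal (𝓞 (W.divisionField p))) = 𝔓.asIdeal →
          ((q : ℕ) : 𝓞 (W.divisionField p)) ∈ 𝔓.asIdeal → ((q : ℕ) : 𝓞 ℚ) ∈ v.asIdeal →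
          (q = p ∨ ¬ W.HasGoodReductionAt v) →
          f (Additive.ofMul (ClassGroup.mk0 I)) = 0) →
      f = 0)
    (hloc : ∀ v : HeightOneSpectrum (𝓞 ℚ), (((p : ℕ) : 𝓞 ℚ) ∈ v.asIdeal ∨ ¬ W.HasGoodReductionAt v) →
      ∀ x : W.geomPrimaryTorsion p, p • x = 0 → (∀ d ∈ decomp v, d • x = x) → x = 0) :
    ∀ (κ : ZpExtension ℚ p), κ.IsCyclotomic →
      ∃ (γ : Field.absoluteGaloisGroup ℚ) (D : W.FineSelmerDualData κ γ),
        Module.Finite ℤ_[p] (RestrictScalars ℤ_[p] (IwasawaAlgebra p) D.X) :=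
  hDRS W p hp hirr hG hhom hloc

end Summit.BirchSwinnertonDyer.BirchSwinnertonDyer.Theorems.TameFineSelmerClassGroupHomRoad
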